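import Summits.Ventures.PercRepro.MSTightCompletion0Lost
import Summits.Ventures.PercRepro.MSTightCompletionLost

/-!
# The excess of a half is at most the excess of its completion; (M0) bounds it by the excess of
the family plus the excess of the trace

Dossier proofs/MINE1-theoremS.md, Addendum 48 supplement 3. For a family `F` and an element `r`
(`P = proj r F`, `F₀ = part0 r F`, `F₁ = partr r F`, `X = diffsX r F`, `Y = diffsY r F`,
`exc(G) = |G \\ G| − |G|`), the completion `F̃ = completion0 r F = F₀ ∪ (P + r)` has
`|F̃| = |F₀| + |P|`, `r`-free differences `D(P)` and `r`-differences `P \\ F₀ = D(F₀) ∪ Y`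
(`diffsX_completion0`, `diffsY_completion0`), so `exc(F̃) = exc(P) + |P \\ F₀| − |F₀|`
(`card_diffs_completion0`) and `exc(F₀) ≤ exc(F̃)` (`card_diffs_part0_le`). Under the
census-true (M0) «`D(F₀) ∩ D(F₁) ⊆ Y`» the chain `|F₁| ≤ |D(F₁)| = |D(F₁) \ D(F₀)| + |D(F₁) ∩ D(F₀)|
≤ |X \ D(F₀)| + |D(F₀) ∩ Y|` gives `|D(F₀) ∪ Y| + |F₁| ≤ |X| + |Y|`, i.e.
**`exc(F₀) ≤ exc(F) + exc(P)`** (`card_diffs_part0_le_of_M0`, the inequality (HX) of Addendum 48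
suppl. 1 (iii) for the `r`-free half, conditional on (M0)); the mirror through
`F̂ = completion1 r F` gives `exc(F₁) ≤ exc(F̂)` (`card_diffs_partr_le`) and (M0) ⟹
`exc(F₁) ≤ exc(F) + exc(P)` (`card_diffs_partr_le_of_M0`). (M0) fails in general while (HX) has no
known counterexample: (HX) is the cardinality shadow of (M0).
-/

namespace PercRepro.MSTight

open Finset
open scoped FinsetFamily

variable {α : Type*} [DecidableEq α] {r : α} {F : Finset (Finset α)}

/-- `|completion0 r F| = |F₀| + |P|` (the two parts are disjoint: `r`-free and `r`-members). -/
theorem card_completion0 : (completion0 r F).card = (part0 r F).card + (proj r F).card := by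
  unfold completion0
  rw [card_union_of_disjoint, card_image_of_injOn]
  · intro A hA B hB hAB
    have hrA : r ∉ A := notMem_of_mem_proj_completion hA
    have hrB : r ∉ B := notMem_of_mem_proj_completion hB
    have h := congrArg (fun S => S.erase r) hAB
    simp only [erase_insert hrA, erase_insert hrB] at h
    exact h
  · rw [disjoint_left]
    intro A hA hA'
    obtain ⟨B, -, rfl⟩ := mem_image.1 hA'
    exact (mem_part0.1 hA).2 (mem_insert_self r B)

/-- The `r`-free differences of `completion0 r F` are the differences of the trace. -/
theorem diffsX_completion0 : diffsX r (completion0 r F) = proj r F \\ proj r F := by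
  unfold diffsX
  rw [part0_completion0, partr_completion0]
  apply Subset.antisymm
  · apply union_subset (union_subset ?_ subset_rfl) ?_
    · exact diffs_subset part0_subset_proj_completion part0_subset_proj_completion
    · exact diffs_subset_right part0_subset_proj_completion
  · exact subset_union_right.trans subset_union_left

/-- The `r`-differences of `completion0 r F` (with `r` removed) are `P \\ F₀`. -/
theorem diffsY_completion0 : diffsY r (completion0 r F) = proj r F \\ part0 r F := by
  unfold diffsY
  rw [part0_completion0, partr_completion0]

/-- `|D(F̃)| = |D(P)| + |P \\ F₀|`. -/
theorem card_diffs_completion0 :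
    (completion0 r F \\ completion0 r F).card =
      (proj r F \\ proj r F).card + (proj r F \\ part0 r F).card := by
  rw [card_diffs_eq_card_X_add_card_Y r, diffsX_completion0, diffsY_completion0]

/-- `P \\ F₀ = D(F₀) ∪ Y`. -/
theorem diffs_proj_part0_eq : proj r F \\ part0 r F = part0 r F \\ part0 r F ∪ diffsY r F := by
  unfold diffsY
  rw [proj_eq_union, diffs_union_left]

/-- **`exc(F₀) ≤ exc(F̃)`**, in additive form:
`|D(F₀)| + |F̃| ≤ |D(F̃)| + |F₀|`. -/
theorem card_diffs_part0_le :
    (part0 r F \\ part0 r F).card + (completion0 r F).card ≤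
      (completion0 r F \\ completion0 r F).card + (part0 r F).card := by
  rw [card_completion0, card_diffs_completion0]
  have h1 : (part0 r F \\ part0 r F).card ≤ (proj r F \\ part0 r F).card :=
    card_le_card (diffs_subset_right part0_subset_proj_completion)
  have h2 := card_le_card_diffs (proj r F)
  omega

/-- **(M0) ⟹ (HX) for the `r`-free half:** if every common difference of the two halves is an
`r`-difference (`D(F₀) ∩ D(F₁) ⊆ Y`), then `exc(F₀) ≤ exc(F) + exc(proj_r F)`, in additive form
`|D(F₀)| + |F| + |P| ≤ |D(F)| + |D(P)| + |F₀|`. -/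
theorem card_diffs_part0_le_of_M0
    (hM0 : part0 r F \\ part0 r F ∩ partr r F \\ partr r F ⊆ diffsY r F) :
    (part0 r F \\ part0 r F).card + F.card + (proj r F).card ≤
      (F \\ F).card + (proj r F \\ proj r F).card + (part0 r F).card := by
  -- notation
  set D0 := part0 r F \\ part0 r F with hD0
  set D1 := partr r F \\ partr r F with hD1
  set X := diffsX r F with hX
  set Y := diffsY r F with hY
  have hXY : (F \\ F).card = X.card + Y.card := card_diffs_eq_card_X_add_card_Y r F
  have hF := card_eq_card_proj_add_card_partner r F
  have hPX : (proj r F \\ proj r F).card = (X ∪ Y).card := by rw [diffs_proj_eq]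
  have hunion := card_union_add_card_inter X Y
  -- `D₀ ∪ D₁ ⊆ X`
  have hD0X : D0 ⊆ X := by
    intro w hw
    exact mem_union.2 (Or.inl (mem_union.2 (Or.inl hw)))
  have hD1X : D1 ⊆ X := by
    intro w hw
    exact mem_union.2 (Or.inl (mem_union.2 (Or.inr hw)))
  -- `|F₁| ≤ |D₁| = |D₁ \ D₀| + |D₁ ∩ D₀| ≤ |X \ D₀| + |D₀ ∩ Y|`
  have h1 : (partr r F).card ≤ D1.card := card_le_card_diffs _
  have h2 : D1.card = (D1 \ D0).card + (D1 ∩ D0).card := by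
    rw [← card_union_of_disjoint (disjoint_sdiff_inter D1 D0), sdiff_union_inter]
  have h3 : (D1 \ D0).card ≤ (X \ D0).card := card_le_card (sdiff_subset_sdiff hD1X subset_rfl)
  have h4 : (D1 ∩ D0).card ≤ (D0 ∩ Y).card := by
    apply card_le_card
    intro w hw
    obtain ⟨hw1, hw0⟩ := mem_inter.1 hw
    exact mem_inter.2 ⟨hw0, hM0 (mem_inter.2 ⟨hw0, hw1⟩)⟩
  -- `|X| = |X \ D₀| + |D₀|`, `|D₀ ∩ Y| ≤ |Y|`, `|P| ≤ |D(P)|`, `|F| = |F₀| + |F₁|`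
  have h5 : X.card = (X \ D0).card + D0.card := by
    rw [← card_union_of_disjoint sdiff_disjoint, sdiff_union_of_subset hD0X]
  have h6 : (D0 ∩ Y).card ≤ Y.card := card_le_card inter_subset_right
  have h7 := card_le_card_diffs (proj r F)
  have h8 : F.card = (part0 r F).card + (partr r F).card := by
    have hp := card_eq_card_proj_add_card_partner r F
    have hu := card_union_add_card_inter (part0 r F) (partr r F)
    rw [proj_eq_union] at hp
    unfold partner at hp
    omega
  omega

/-- `|completion1 r F| = |P| + |F₁|`. -/
theorem card_completion1 : (completion1 r F).card = (proj r F).card + (partr r F).card := by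
  unfold completion1
  rw [card_union_of_disjoint, card_image_of_injOn]
  · intro A hA B hB hAB
    have hrA : r ∉ A := (mem_partr.1 hA).1
    have hrB : r ∉ B := (mem_partr.1 hB).1
    have h := congrArg (fun S => S.erase r) hAB
    simp only [erase_insert hrA, erase_insert hrB] at h
    exact h
  · rw [disjoint_left]
    intro A hA hA'
    obtain ⟨B, -, rfl⟩ := mem_image.1 hA'
    exact notMem_of_mem_proj_completion hA (mem_insert_self r B)

/-- The `r`-free differences of `completion1 r F` are the differences of the trace. -/
theorem diffsX_completion1 : diffsX r (completion1 r F) = proj r F \\ proj r F := by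
  unfold diffsX
  rw [part0_completion1, partr_completion1]
  apply Subset.antisymm
  · apply union_subset (union_subset subset_rfl ?_) ?_
    · exact diffs_subset partr_subset_proj_completion partr_subset_proj_completion
    · exact diffs_subset_left partr_subset_proj_completion
  · exact subset_union_left.trans subset_union_left

/-- The `r`-differences of `completion1 r F` (with `r` removed) are `F₁ \\ P`. -/
theorem diffsY_completion1 : diffsY r (completion1 r F) = partr r F \\ proj r F := by
  unfold diffsY
  rw [part0_completion1, partr_completion1]

/-- `|D(F̂)| = |D(P)| + |F₁ \\ P|`. -/
theorem card_diffs_completion1 :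
    (completion1 r F \\ completion1 r F).card =
      (proj r F \\ proj r F).card + (partr r F \\ proj r F).card := by
  rw [card_diffs_eq_card_X_add_card_Y r, diffsX_completion1, diffsY_completion1]

/-- **`exc(F₁) ≤ exc(F̂)`**, in additive form. -/
theorem card_diffs_partr_le :
    (partr r F \\ partr r F).card + (completion1 r F).card ≤
      (completion1 r F \\ completion1 r F).card + (partr r F).card := by
  rw [card_completion1, card_diffs_completion1]
  have h1 : (partr r F \\ partr r F).card ≤ (partr r F \\ proj r F).card :=
    card_le_card (diffs_subset_left partr_subset_proj_completion)
  have h2 := card_le_card_diffs (proj r F)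
  omega

/-- **(M0) ⟹ (HX) for the `r`-half:** `D(F₀) ∩ D(F₁) ⊆ Y` implies `exc(F₁) ≤ exc(F) + exc(P)`,
in additive form `|D(F₁)| + |F| + |P| ≤ |D(F)| + |D(P)| + |F₁|`. -/
theorem card_diffs_partr_le_of_M0
    (hM0 : part0 r F \\ part0 r F ∩ partr r F \\ partr r F ⊆ diffsY r F) :
    (partr r F \\ partr r F).card + F.card + (proj r F).card ≤
      (F \\ F).card + (proj r F \\ proj r F).card + (partr r F).card := by
  set D0 := part0 r F \\ part0 r F with hD0
  set D1 := partr r F \\ partr r F with hD1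
  set X := diffsX r F with hX
  set Y := diffsY r F with hY
  have hXY : (F \\ F).card = X.card + Y.card := card_diffs_eq_card_X_add_card_Y r F
  have hPX : (proj r F \\ proj r F).card = (X ∪ Y).card := by rw [diffs_proj_eq]
  have hD0X : D0 ⊆ X := by
    intro w hw
    exact mem_union.2 (Or.inl (mem_union.2 (Or.inl hw)))
  have hD1X : D1 ⊆ X := by
    intro w hw
    exact mem_union.2 (Or.inl (mem_union.2 (Or.inr hw)))
  have h1 : (part0 r F).card ≤ D0.card := card_le_card_diffs _
  have h2 : D0.card = (D0 \ D1).card + (D0 ∩ D1).card := by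
    rw [← card_union_of_disjoint (disjoint_sdiff_inter D0 D1), sdiff_union_inter]
  have h3 : (D0 \ D1).card ≤ (X \ D1).card := card_le_card (sdiff_subset_sdiff hD0X subset_rfl)
  have h4 : (D0 ∩ D1).card ≤ (D1 ∩ Y).card := by
    apply card_le_card
    intro w hw
    obtain ⟨hw0, hw1⟩ := mem_inter.1 hw
    exact mem_inter.2 ⟨hw1, hM0 (mem_inter.2 ⟨hw0, hw1⟩)⟩
  have h5 : X.card = (X \ D1).card + D1.card := by
    rw [← card_union_of_disjoint sdiff_disjoint, sdiff_union_of_subset hD1X]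
  have h6 : (D1 ∩ Y).card ≤ Y.card := card_le_card inter_subset_right
  have h7 := card_le_card_diffs (proj r F)
  have h8 : F.card = (part0 r F).card + (partr r F).card := by
    have hp := card_eq_card_proj_add_card_partner r F
    have hu := card_union_add_card_inter (part0 r F) (partr r F)
    rw [proj_eq_union] at hp
    unfold partner at hp
    omega
  omega

end PercRepro.MSTight
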